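import Literature.Probability.RandomPlanarGeometry.LoewnerImageStepResidue
import HarnessLib

/-!
# One step of the conformal image of a Loewner chain, IV: the drift function and its jet at `0`

Sequel to `LoewnerImageStepResidue`. The drift `D = driftFun Φ d ρ₀` of the first-order
expansion `h' - h = 2u D + O(u(η + u))` was defined there as the Cauchy integral over
`|ζ| = ρ₀/2` of `F₀(ζ) = d²/E_B(ζ) - E_B'(ζ)/ζ`. Here we identify it with the holomorphic
extension of `F₀` across `0` and compute its jet at `0` in terms of the jet of `E_B`
(`E_B(0) = 0`, `E_B'(0) = d`):

* `driftFun_eq_of_ne_zero`: `D(z) = d²/E_B(z) - E_B'(z)/z` for `0 < |z| < ρ₀/2`;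
* `driftFun_zero`: **`D(0) = -(3/2) E_B''(0)`**;
* `hasDerivAt_driftFun_zero`: **`D'(0) = E_B''(0)²/(4d) - (2/3) E_B'''(0)`**;
* `differentiableOn_driftFun`: `D` is holomorphic on `B(0, ρ₀/2)`.

In the original coordinates (`h_t(z) = E_{B_t}(z - W_t) + const`, `d = h_t'(W_t)`,
`E_B'' (0) = h_t''(W_t)`, `E_B'''(0) = h_t'''(W_t)`, and `∂_t = 2·D` by Part III) these are
Lawler's (4.35) `∂_t h_t(W_t) = -3 h_t''(W_t)` and (4.37)
`∂_t h_t'(W_t) = h_t''(W_t)²/(2 h_t'(W_t)) - (4/3) h_t'''(W_t)`, the two identities behind the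
Itô computation of [LSW] Prop. 5.2 / (5.3). The proof writes `E_B(z) = z σ(z)` (`σ = dslope E_B 0`,
`σ(0) = d`), `F₀ = N/z` with `N = d²/σ - E_B'`, `N(0) = 0`, so that the extension is
`G = dslope N 0`, and uses `(dslope f 0)'(0) = f''(0)/2`, `(dslope f 0)''(0) = f'''(0)/3`.

## References

* G. F. Lawler, *Conformally Invariant Processes in the Plane* (2005), §4.6.1, (4.35)–(4.37)
  and Prop. 4.40 [Lawler2005].
* G. F. Lawler, O. Schramm, W. Werner, *Conformal restriction: the chordal case* (2003), §5
  (5.2)–(5.3) [LawlerSchrammWerner2003Restriction].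
-/

noncomputable section

open Set Filter Metric Function
open _root_.Complex _root_.Topology _root_.Real
open UpperHalfPlane (upperHalfPlaneSet)
open scoped NNReal

namespace Literature.Probability.RandomPlanarGeometry

namespace Loewner

/-! ### Derivatives of `dslope f a` at the base point -/

section DSlope

variable {f : ℂ → ℂ} {a : ℂ} {s : Set ℂ}

/-- For `f` holomorphic near `a`: `f'' (a) = 2 (dslope f a)'(a)` and `f'''(a) = 3 (dslope f a)''(a)`
(differentiate `f(z) = f(a) + (z - a) σ(z)` two and three times). [folklore] -/
theorem deriv_deriv_eq_dslope (hs : s ∈ 𝓝 a) (hso : IsOpen s) (hf : DifferentiableOn ℂ f s) :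
    deriv (deriv f) a = 2 * deriv (dslope f a) a ∧
      deriv (deriv (deriv f)) a = 3 * deriv (deriv (dslope f a)) a := by
  set σ := dslope f a with hσ
  have hσd : DifferentiableOn ℂ σ s := (Complex.differentiableOn_dslope hs).2 hf
  -- all derivatives of `σ` exist on `s`
  have hσA : AnalyticOnNhd ℂ σ s := hσd.analyticOnNhd hso
  set σ₁ := deriv σ with hσ₁
  set σ₂ := deriv σ₁ with hσ₂
  set σ₃ := deriv σ₂ with hσ₃
  have h1 : ∀ z ∈ s, HasDerivAt σ (σ₁ z) z := fun z hz ↦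
    (hσA z hz).differentiableAt.hasDerivAt
  have h2 : ∀ z ∈ s, HasDerivAt σ₁ (σ₂ z) z := fun z hz ↦
    (hσA.deriv z hz).differentiableAt.hasDerivAt
  have h3 : ∀ z ∈ s, HasDerivAt σ₂ (σ₃ z) z := fun z hz ↦
    (hσA.deriv.deriv z hz).differentiableAt.hasDerivAt
  -- `f z = f a + (z - a) * σ z`
  have hf_eq : f = fun z ↦ f a + (z - a) * σ z := by
    funext z
    have := sub_smul_dslope f a z
    rw [smul_eq_mul] at this
    rw [hσ, this]; ring
  -- first derivative: `f' z = σ z + (z - a) σ₁ z` on `s`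
  have hd1 : ∀ z ∈ s, HasDerivAt f (σ z + (z - a) * σ₁ z) z := fun z hz ↦ by
    rw [hf_eq]
    have := (((hasDerivAt_id z).sub_const a).mul (h1 z hz)).const_add (f a)
    simpa using this
  have hd1' : ∀ z ∈ s, deriv f z = σ z + (z - a) * σ₁ z := fun z hz ↦ (hd1 z hz).deriv
  -- second derivative
  have hd2 : ∀ z ∈ s, HasDerivAt (deriv f) (2 * σ₁ z + (z - a) * σ₂ z) z := fun z hz ↦ by
    have hev : deriv f =ᶠ[𝓝 z] fun w ↦ σ w + (w - a) * σ₁ w :=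
      Filter.eventually_of_mem (hso.mem_nhds hz) hd1'
    rw [hev.hasDerivAt_iff]
    refine ((h1 z hz).add (((hasDerivAt_id z).sub_const a).mul (h2 z hz))).congr_deriv ?_
    simp only [id_eq]; ring
  have hd2' : ∀ z ∈ s, deriv (deriv f) z = 2 * σ₁ z + (z - a) * σ₂ z := fun z hz ↦ (hd2 z hz).deriv
  -- third derivative
  have hd3 : ∀ z ∈ s, HasDerivAt (deriv (deriv f)) (3 * σ₂ z + (z - a) * σ₃ z) z := fun z hz ↦ by
    have hev : deriv (deriv f) =ᶠ[𝓝 z] fun w ↦ 2 * σ₁ w + (w - a) * σ₂ w :=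
      Filter.eventually_of_mem (hso.mem_nhds hz) hd2'
    rw [hev.hasDerivAt_iff]
    refine (((h2 z hz).const_mul 2).add (((hasDerivAt_id z).sub_const a).mul (h3 z hz))).congr_deriv ?_
    simp only [id_eq]; ring
  have ha : a ∈ s := mem_of_mem_nhds hs
  refine ⟨?_, ?_⟩
  · rw [hd2' a ha]; simp [hσ₁]
  · rw [(hd3 a ha).deriv]; simp [hσ₂, hσ₁]

end DSlope

/-! ### The drift function as a holomorphic extension -/

variable {B : Set ℂ} {Φ : ConformalEquiv (upperHalfPlaneSet \ B) upperHalfPlaneSet} {d ρ₀ : ℝ}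
variable (hB : IsStarHull B) (hΦ : IsRestrictionMap B Φ) (hd : HasRestrictionDeriv B Φ d)
  (hρ₀ : 0 < ρ₀) (hBρ : Disjoint (ball (0 : ℂ) (8 * ρ₀)) B)

/-- The auxiliary numerator `N = d²/σ - E_B'`, `σ = dslope E_B 0` (so that
`d²/E_B(z) - E_B'(z)/z = N(z)/z` off `0`, `N(0) = 0`). [folklore] -/
def driftNum (Φ : ConformalEquiv (upperHalfPlaneSet \ B) upperHalfPlaneSet) (d : ℝ) (z : ℂ) : ℂ :=
  (d : ℂ) ^ 2 / dslope (hullExt Φ) 0 z - deriv (hullExt Φ) z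

include hB hΦ hd hρ₀ hBρ in
/-- Properties of `σ = dslope E_B 0` on `B(0, 4ρ₀)`: holomorphic, `σ(0) = d`, `z σ(z) = E_B(z)`,
`σ ≠ 0`. [folklore] -/
theorem dslope_hullExt_spec :
    DifferentiableOn ℂ (dslope (hullExt Φ) 0) (ball (0 : ℂ) (4 * ρ₀)) ∧
      dslope (hullExt Φ) 0 0 = d ∧
      (∀ z, z * dslope (hullExt Φ) 0 z = hullExt Φ z) ∧
      ∀ z ∈ ball (0 : ℂ) (4 * ρ₀), dslope (hullExt Φ) 0 z ≠ 0 := by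
  obtain ⟨-, hE, -⟩ := differentiableOn_hmap hB hΦ hρ₀ hBρ
  have h0 : ball (0 : ℂ) (4 * ρ₀) ∈ 𝓝 (0 : ℂ) := isOpen_ball.mem_nhds (mem_ball_self (by positivity))
  have hσd : DifferentiableOn ℂ (dslope (hullExt Φ) 0) (ball (0 : ℂ) (4 * ρ₀)) :=
    (Complex.differentiableOn_dslope h0).2 hE
  have hσ0 : dslope (hullExt Φ) 0 0 = d := by
    rw [dslope_same, deriv_hullExt_zero hB hΦ hd]
  have hmul : ∀ z, z * dslope (hullExt Φ) 0 z = hullExt Φ z := fun z ↦ by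
    have := sub_smul_dslope (hullExt Φ) 0 z
    rw [smul_eq_mul, sub_zero, hullExt_zero hB hΦ, sub_zero] at this
    exact this
  refine ⟨hσd, hσ0, hmul, fun z hz h ↦ ?_⟩
  rcases eq_or_ne z 0 with rfl | hz0
  · rw [hσ0] at h
    exact (restrictionDeriv_pos_le_one hB hΦ hd).1.ne' (by exact_mod_cast h)
  · have := hmul z
    rw [h, mul_zero] at this
    exact hullExt_ne_zero hB hΦ hd hρ₀ hBρ hz hz0 this.symm

include hB hΦ hd hρ₀ hBρ in
/-- `N` is holomorphic on `B(0, 4ρ₀)`, `N(0) = 0`, and `N(z)/z = d²/E_B(z) - E_B'(z)/z` off `0`.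
[folklore] -/
theorem driftNum_spec :
    DifferentiableOn ℂ (driftNum Φ d) (ball (0 : ℂ) (4 * ρ₀)) ∧ driftNum Φ d 0 = 0 ∧
      ∀ z ∈ ball (0 : ℂ) (4 * ρ₀), z ≠ 0 →
        driftNum Φ d z / z = (d : ℂ) ^ 2 / hullExt Φ z - deriv (hullExt Φ) z / z := by
  obtain ⟨-, hE, -⟩ := differentiableOn_hmap hB hΦ hρ₀ hBρ
  obtain ⟨hσd, hσ0, hmul, hσne⟩ := dslope_hullExt_spec hB hΦ hd hρ₀ hBρ
  have hd0 := (restrictionDeriv_pos_le_one hB hΦ hd).1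
  have hE' : DifferentiableOn ℂ (deriv (hullExt Φ)) (ball (0 : ℂ) (4 * ρ₀)) :=
    ((hE.analyticOnNhd isOpen_ball).deriv).differentiableOn
  refine ⟨((differentiableOn_const _).div hσd hσne).sub hE', ?_, fun z hz hz0 ↦ ?_⟩
  · rw [driftNum, hσ0, deriv_hullExt_zero hB hΦ hd]
    have hd0' : (d : ℂ) ≠ 0 := ofReal_ne_zero.2 hd0.ne'
    field_simp
    ring
  · rw [driftNum, sub_div, ← hmul z]
    have hσz := hσne z hz
    field_simp

include hB hΦ hd hρ₀ hBρ in
/-- **The drift function is the holomorphic extension of `d²/E_B - E_B'/ζ`**: on `B(0, ρ₀/2)`,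
`driftFun Φ d ρ₀ = dslope N 0` (Cauchy's integral formula). [folklore] -/
theorem driftFun_eq_dslope {z : ℂ} (hz : z ∈ ball (0 : ℂ) (ρ₀ / 2)) :
    driftFun Φ d ρ₀ z = dslope (driftNum Φ d) 0 z := by
  obtain ⟨hNd, hN0, hNeq⟩ := driftNum_spec hB hΦ hd hρ₀ hBρ
  have hρ2 : 0 < ρ₀ / 2 := by positivity
  have h0 : ball (0 : ℂ) (4 * ρ₀) ∈ 𝓝 (0 : ℂ) := isOpen_ball.mem_nhds (mem_ball_self (by positivity))
  have hGd : DifferentiableOn ℂ (dslope (driftNum Φ d) 0) (ball (0 : ℂ) (4 * ρ₀)) :=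
    (Complex.differentiableOn_dslope h0).2 hNd
  have hGc : DiffContOnCl ℂ (dslope (driftNum Φ d) 0) (ball (0 : ℂ) (ρ₀ / 2)) := by
    refine DifferentiableOn.diffContOnCl ?_
    rw [closure_ball 0 hρ2.ne']
    exact hGd.mono (closedBall_subset_ball (by linarith))
  rw [← hGc.two_pi_i_inv_smul_circleIntegral_sub_inv_smul hz, driftFun]
  congr 1
  refine circleIntegral.integral_congr hρ2.le fun ζ hζ ↦ ?_
  have hζ' : ‖ζ‖ = ρ₀ / 2 := by simpa using hζ
  have hζ0 : ζ ≠ 0 := by intro h; rw [h, norm_zero] at hζ'; linarith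
  have hζ4 : ζ ∈ ball (0 : ℂ) (4 * ρ₀) := mem_ball_zero_iff.2 (by linarith)
  rw [dslope_of_ne _ hζ0, slope_def_field, hN0, sub_zero, sub_zero, hNeq ζ hζ4 hζ0]

include hB hΦ hd hρ₀ hBρ in
/-- `D = driftFun Φ d ρ₀` is holomorphic on `B(0, ρ₀/2)`. [folklore] -/
theorem differentiableOn_driftFun : DifferentiableOn ℂ (driftFun Φ d ρ₀) (ball (0 : ℂ) (ρ₀ / 2)) := by
  obtain ⟨hNd, -, -⟩ := driftNum_spec hB hΦ hd hρ₀ hBρ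
  have h0 : ball (0 : ℂ) (4 * ρ₀) ∈ 𝓝 (0 : ℂ) := isOpen_ball.mem_nhds (mem_ball_self (by positivity))
  have hGd : DifferentiableOn ℂ (dslope (driftNum Φ d) 0) (ball (0 : ℂ) (4 * ρ₀)) :=
    (Complex.differentiableOn_dslope h0).2 hNd
  refine (hGd.mono (ball_subset_ball (by linarith))).congr fun z hz ↦ ?_
  exact driftFun_eq_dslope hB hΦ hd hρ₀ hBρ hz

include hB hΦ hd hρ₀ hBρ in
/-- **`D(z) = d²/E_B(z) - E_B'(z)/z` for `0 < |z| < ρ₀/2`.** [cite: Lawler2005, Prop. 4.40] -/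
theorem driftFun_eq_of_ne_zero {z : ℂ} (hz : z ∈ ball (0 : ℂ) (ρ₀ / 2)) (hz0 : z ≠ 0) :
    driftFun Φ d ρ₀ z = (d : ℂ) ^ 2 / hullExt Φ z - deriv (hullExt Φ) z / z := by
  obtain ⟨-, hN0, hNeq⟩ := driftNum_spec hB hΦ hd hρ₀ hBρ
  rw [driftFun_eq_dslope hB hΦ hd hρ₀ hBρ hz, dslope_of_ne _ hz0, slope_def_field, hN0, sub_zero,
    sub_zero, hNeq z (ball_subset_ball (by linarith) hz) hz0]

/-! ### The jet of `D` at `0` -/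

include hB hΦ hd hρ₀ hBρ in
/-- The first two derivatives of `N = d²/σ - E_B'` at `0`:
`N'(0) = -(3/2) E_B''(0)`, `N''(0) = E_B''(0)²/(2d) - (4/3) E_B'''(0)`
(`σ(0) = d`, `σ'(0) = E_B''(0)/2`, `σ''(0) = E_B'''(0)/3`). [folklore] -/
theorem deriv_driftNum_zero :
    deriv (driftNum Φ d) 0 = -(3 / 2 : ℂ) * deriv (deriv (hullExt Φ)) 0 ∧
      deriv (deriv (driftNum Φ d)) 0 =
        (deriv (deriv (hullExt Φ)) 0) ^ 2 / (2 * (d : ℂ)) -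
          (4 / 3 : ℂ) * deriv (deriv (deriv (hullExt Φ))) 0 := by
  obtain ⟨-, hE, -⟩ := differentiableOn_hmap hB hΦ hρ₀ hBρ
  obtain ⟨hσd, hσ0, hmul, hσne⟩ := dslope_hullExt_spec hB hΦ hd hρ₀ hBρ
  have hd0 := (restrictionDeriv_pos_le_one hB hΦ hd).1
  have hd0' : (d : ℂ) ≠ 0 := ofReal_ne_zero.2 hd0.ne'
  set s := ball (0 : ℂ) (4 * ρ₀) with hs
  have h0s : (0 : ℂ) ∈ s := mem_ball_self (by positivity)
  have hs0 : s ∈ 𝓝 (0 : ℂ) := isOpen_ball.mem_nhds h0s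
  set σ := dslope (hullExt Φ) 0 with hσ
  have hσA : AnalyticOnNhd ℂ σ s := hσd.analyticOnNhd isOpen_ball
  have hEA : AnalyticOnNhd ℂ (hullExt Φ) s := hE.analyticOnNhd isOpen_ball
  set σ₁ := deriv σ with hσ₁
  set σ₂ := deriv σ₁ with hσ₂
  -- `σ'(0) = E''(0)/2`, `σ''(0) = E'''(0)/3`
  obtain ⟨hj2, hj3⟩ := deriv_deriv_eq_dslope (f := hullExt Φ) hs0 isOpen_ball hE
  have hσ₁0 : σ₁ 0 = deriv (deriv (hullExt Φ)) 0 / 2 := by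
    rw [hj2, hσ₁, hσ]; ring
  have hσ₂0 : σ₂ 0 = deriv (deriv (deriv (hullExt Φ))) 0 / 3 := by
    rw [hj3, hσ₂, hσ₁, hσ]; ring
  -- derivatives of `N = d² σ⁻¹ - E'` on `s`
  set E₁ := deriv (hullExt Φ) with hE₁
  set E₂ := deriv E₁ with hE₂
  set E₃ := deriv E₂ with hE₃
  have hσ' : ∀ z ∈ s, HasDerivAt σ (σ₁ z) z := fun z hz ↦ (hσA z hz).differentiableAt.hasDerivAt
  have hσ₁' : ∀ z ∈ s, HasDerivAt σ₁ (σ₂ z) z := fun z hz ↦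
    (hσA.deriv z hz).differentiableAt.hasDerivAt
  have hE₁' : ∀ z ∈ s, HasDerivAt E₁ (E₂ z) z := fun z hz ↦
    (hEA.deriv z hz).differentiableAt.hasDerivAt
  have hE₂' : ∀ z ∈ s, HasDerivAt E₂ (E₃ z) z := fun z hz ↦
    (hEA.deriv.deriv z hz).differentiableAt.hasDerivAt
  have hN_eq : driftNum Φ d = fun z ↦ (d : ℂ) ^ 2 * (σ z)⁻¹ - E₁ z := by
    funext z; simp only [driftNum, hσ, hE₁, div_eq_mul_inv]
  -- `N' z = -d² σ₁ z / σ z ^ 2 - E₂ z`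
  have hN1 : ∀ z ∈ s, HasDerivAt (driftNum Φ d) (-(d : ℂ) ^ 2 * σ₁ z / σ z ^ 2 - E₂ z) z := by
    intro z hz
    rw [hN_eq]
    refine ((((hσ' z hz).inv (hσne z hz)).const_mul ((d : ℂ) ^ 2)).sub (hE₁' z hz)).congr_deriv ?_
    ring
  have hN1' : ∀ z ∈ s, deriv (driftNum Φ d) z = -(d : ℂ) ^ 2 * σ₁ z / σ z ^ 2 - E₂ z := fun z hz ↦
    (hN1 z hz).deriv
  -- `N'' z = -d² σ₂/σ² + 2 d² σ₁²/σ³ - E₃`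
  have hN2 : HasDerivAt (deriv (driftNum Φ d))
      (-(d : ℂ) ^ 2 * σ₂ 0 / σ 0 ^ 2 + 2 * (d : ℂ) ^ 2 * σ₁ 0 ^ 2 / σ 0 ^ 3 - E₃ 0) 0 := by
    have hev : deriv (driftNum Φ d) =ᶠ[𝓝 0] fun w ↦ -(d : ℂ) ^ 2 * σ₁ w / σ w ^ 2 - E₂ w :=
      Filter.eventually_of_mem hs0 hN1'
    rw [hev.hasDerivAt_iff]
    have hσ00 : σ 0 ≠ 0 := hσne 0 h0s
    have h1 := ((hσ₁' 0 h0s).const_mul (-(d : ℂ) ^ 2)).div ((hσ' 0 h0s).pow 2) (pow_ne_zero 2 hσ00)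
    refine (h1.sub (hE₂' 0 h0s)).congr_deriv ?_
    simp only [Pi.pow_apply]
    norm_num
    field_simp
  refine ⟨?_, ?_⟩
  · rw [hN1' 0 h0s, hσ0, hσ₁0]
    change -(d : ℂ) ^ 2 * (deriv (deriv (hullExt Φ)) 0 / 2) / (d : ℂ) ^ 2 - deriv E₁ 0 = _
    rw [hE₁]
    field_simp
    ring
  · rw [hN2.deriv, hσ0, hσ₁0, hσ₂0]
    change _ - deriv E₂ 0 = _
    rw [hE₂, hE₁]
    field_simp
    ring

include hB hΦ hd hρ₀ hBρ in
/-- **`D(0) = -(3/2) E_B''(0)`** (Lawler (4.35): `∂_t h_t(W_t) = -3 h_t''(W_t)`, with `∂_t = 2D`).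
[cite: Lawler2005, (4.35)] -/
theorem driftFun_zero : driftFun Φ d ρ₀ 0 = -(3 / 2 : ℂ) * deriv (deriv (hullExt Φ)) 0 := by
  rw [driftFun_eq_dslope hB hΦ hd hρ₀ hBρ (mem_ball_self (by positivity)), dslope_same,
    (deriv_driftNum_zero hB hΦ hd hρ₀ hBρ).1]

include hB hΦ hd hρ₀ hBρ in
/-- **`D'(0) = E_B''(0)²/(4d) - (2/3) E_B'''(0)`** (Lawler (4.37):
`∂_t h_t'(W_t) = h_t''(W_t)²/(2h_t'(W_t)) - (4/3) h_t'''(W_t)`, with `∂_t = 2D`).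
[cite: Lawler2005, (4.37)] -/
theorem hasDerivAt_driftFun_zero :
    HasDerivAt (driftFun Φ d ρ₀)
      ((deriv (deriv (hullExt Φ)) 0) ^ 2 / (4 * (d : ℂ)) -
        (2 / 3 : ℂ) * deriv (deriv (deriv (hullExt Φ))) 0) 0 := by
  obtain ⟨hNd, -, -⟩ := driftNum_spec hB hΦ hd hρ₀ hBρ
  have hd0 := (restrictionDeriv_pos_le_one hB hΦ hd).1
  have hd0' : (d : ℂ) ≠ 0 := ofReal_ne_zero.2 hd0.ne'
  have h0 : ball (0 : ℂ) (4 * ρ₀) ∈ 𝓝 (0 : ℂ) := isOpen_ball.mem_nhds (mem_ball_self (by positivity))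
  have hρ2 : ball (0 : ℂ) (ρ₀ / 2) ∈ 𝓝 (0 : ℂ) := isOpen_ball.mem_nhds (mem_ball_self (by positivity))
  -- `D = dslope N 0` near `0`
  have hev : driftFun Φ d ρ₀ =ᶠ[𝓝 0] dslope (driftNum Φ d) 0 :=
    Filter.eventually_of_mem hρ2 fun z hz ↦ driftFun_eq_dslope hB hΦ hd hρ₀ hBρ hz
  rw [hev.hasDerivAt_iff]
  have hGd : DifferentiableOn ℂ (dslope (driftNum Φ d) 0) (ball (0 : ℂ) (4 * ρ₀)) :=
    (Complex.differentiableOn_dslope h0).2 hNd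
  have hG : HasDerivAt (dslope (driftNum Φ d) 0) (deriv (dslope (driftNum Φ d) 0) 0) 0 :=
    (hGd.differentiableAt h0).hasDerivAt
  refine hG.congr_deriv ?_
  -- `(dslope N 0)'(0) = N''(0)/2`
  obtain ⟨hk2, -⟩ := deriv_deriv_eq_dslope (f := driftNum Φ d) h0 isOpen_ball hNd
  have : deriv (dslope (driftNum Φ d) 0) 0 = deriv (deriv (driftNum Φ d)) 0 / 2 := by
    rw [hk2]; ring
  rw [this, (deriv_driftNum_zero hB hΦ hd hρ₀ hBρ).2]
  field_simp
  ring


/-! ### Cauchy bounds for the jets of `E_B` and `D` near `0` -/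

/-- A generic Cauchy step: if `F` is holomorphic on `B(0, R₀)` and `‖F‖ ≤ M` on `B̄(0, r + r')`
with `r + r' < R₀`, then `‖F'‖ ≤ M/r'` on `B̄(0, r)`. [folklore] -/
theorem norm_deriv_le_of_forall_closedBall {F : ℂ → ℂ} {R₀ r r' M : ℝ} (hr' : 0 < r')
    (hR : r + r' < R₀) (hF : DifferentiableOn ℂ F (ball (0 : ℂ) R₀))
    (hM : ∀ w ∈ closedBall (0 : ℂ) (r + r'), ‖F w‖ ≤ M) {z : ℂ} (hz : z ∈ closedBall (0 : ℂ) r) :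
    ‖deriv F z‖ ≤ M / r' := by
  have hcl : closedBall z r' ⊆ closedBall (0 : ℂ) (r + r') := by
    intro w hw
    rw [mem_closedBall, dist_eq_norm] at hw
    rw [mem_closedBall_zero_iff] at hz ⊢
    calc ‖w‖ = ‖(w - z) + z‖ := by ring_nf
      _ ≤ ‖w - z‖ + ‖z‖ := norm_add_le _ _
      _ ≤ r + r' := by linarith
  refine Complex.norm_deriv_le_of_forall_mem_sphere_norm_le hr' ?_ fun w hw ↦ hM w (hcl (sphere_subset_closedBall hw))
  refine DifferentiableOn.diffContOnCl ?_
  rw [closure_ball z hr'.ne']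
  exact hF.mono (hcl.trans (closedBall_subset_ball hR))

include hB hΦ hρ₀ hBρ in
/-- **Jet bounds for `E_B`**: `|E_B'| ≤ 2` on `B(0, 4ρ₀)`, `|E_B''| ≤ 1/ρ₀` on `B̄(0, ρ₀)`,
`|E_B⁽³⁾| ≤ 2/ρ₀²` on `B̄(0, ρ₀/2)`, `|E_B⁽⁴⁾| ≤ 8/ρ₀³` on `B̄(0, ρ₀/4)` (Schwarz–Pick and Cauchy).
[folklore] -/
theorem norm_iteratedDeriv_hullExt_le :
    (∀ z ∈ ball (0 : ℂ) (4 * ρ₀), ‖deriv (hullExt Φ) z‖ ≤ 2) ∧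
    (∀ z ∈ closedBall (0 : ℂ) ρ₀, ‖deriv (deriv (hullExt Φ)) z‖ ≤ 1 / ρ₀) ∧
    (∀ z ∈ closedBall (0 : ℂ) (ρ₀ / 2), ‖deriv (deriv (deriv (hullExt Φ))) z‖ ≤ 2 / ρ₀ ^ 2) ∧
    (∀ z ∈ closedBall (0 : ℂ) (ρ₀ / 4), ‖deriv (deriv (deriv (deriv (hullExt Φ)))) z‖ ≤ 8 / ρ₀ ^ 3) := by
  obtain ⟨hsub, hE, -⟩ := differentiableOn_hmap hB hΦ hρ₀ hBρ
  have hA : AnalyticOnNhd ℂ (hullExt Φ) (ball (0 : ℂ) (4 * ρ₀)) := hE.analyticOnNhd isOpen_ball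
  have h1 : ∀ z ∈ ball (0 : ℂ) (4 * ρ₀), ‖deriv (hullExt Φ) z‖ ≤ 2 := fun z hz ↦ by
    refine norm_deriv_hullExt_le_two hB.isBoundedHull hΦ (x := 0) (r := 8 * ρ₀) (by simpa using hBρ) ?_
    simpa [show (8 : ℝ) * ρ₀ / 2 = 4 * ρ₀ by ring] using hz
  have h2 : ∀ z ∈ closedBall (0 : ℂ) ρ₀, ‖deriv (deriv (hullExt Φ)) z‖ ≤ 1 / ρ₀ := fun z hz ↦ by
    have := norm_deriv_le_of_forall_closedBall (F := deriv (hullExt Φ)) (r := ρ₀) (r' := 2 * ρ₀) (M := 2)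
      (by positivity) (by linarith) hA.deriv.differentiableOn
      (fun w hw ↦ h1 w (closedBall_subset_ball (by linarith) hw)) hz
    refine this.trans (le_of_eq ?_); field_simp
  have h3 : ∀ z ∈ closedBall (0 : ℂ) (ρ₀ / 2), ‖deriv (deriv (deriv (hullExt Φ))) z‖ ≤ 2 / ρ₀ ^ 2 :=
    fun z hz ↦ by
    have := norm_deriv_le_of_forall_closedBall (F := deriv (deriv (hullExt Φ))) (r := ρ₀ / 2) (r' := ρ₀ / 2)
      (M := 1 / ρ₀) (by positivity) (by linarith) hA.deriv.deriv.differentiableOn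
      (fun w hw ↦ h2 w (by simpa [show ρ₀ / 2 + ρ₀ / 2 = ρ₀ by ring] using hw)) hz
    refine this.trans (le_of_eq ?_); field_simp
  have h4 : ∀ z ∈ closedBall (0 : ℂ) (ρ₀ / 4),
      ‖deriv (deriv (deriv (deriv (hullExt Φ)))) z‖ ≤ 8 / ρ₀ ^ 3 := fun z hz ↦ by
    have := norm_deriv_le_of_forall_closedBall (F := deriv (deriv (deriv (hullExt Φ)))) (r := ρ₀ / 4)
      (r' := ρ₀ / 4) (M := 2 / ρ₀ ^ 2) (by positivity) (by linarith)
      hA.deriv.deriv.deriv.differentiableOn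
      (fun w hw ↦ h3 w (by simpa [show ρ₀ / 4 + ρ₀ / 4 = ρ₀ / 2 by ring] using hw)) hz
    refine this.trans (le_of_eq ?_); field_simp; ring
  exact ⟨h1, h2, h3, h4⟩

/-- A generic third-order Taylor bound from a fourth-derivative bound (mean value inequality three
times): if `F` is holomorphic on `B(0, R₀) ⊇ B̄(0, r)` and `‖F⁽⁴⁾‖ ≤ M` on `B̄(0, r)`, then
`‖F'(z) - F'(0) - F''(0) z - F⁽³⁾(0) z²/2‖ ≤ M ‖z‖³` for `‖z‖ ≤ r`. [folklore] -/
theorem norm_deriv_sub_taylor_le {F : ℂ → ℂ} {R₀ r M : ℝ} (hrR : r < R₀)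
    (hF : DifferentiableOn ℂ F (ball (0 : ℂ) R₀))
    (hM : ∀ w ∈ closedBall (0 : ℂ) r, ‖deriv (deriv (deriv (deriv F))) w‖ ≤ M)
    {z : ℂ} (hz : ‖z‖ ≤ r) :
    ‖deriv F z - deriv F 0 - deriv (deriv F) 0 * z - deriv (deriv (deriv F)) 0 * z ^ 2 / 2‖ ≤ M * ‖z‖ ^ 3 := by
  have hA : AnalyticOnNhd ℂ F (ball (0 : ℂ) R₀) := hF.analyticOnNhd isOpen_ball
  set F₁ := deriv F with hF₁
  set F₂ := deriv F₁ with hF₂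
  set F₃ := deriv F₂ with hF₃
  set F₄ := deriv F₃ with hF₄
  set s : Set ℂ := closedBall (0 : ℂ) ‖z‖ with hs
  have hsconv : Convex ℝ s := convex_closedBall _ _
  have h0s : (0 : ℂ) ∈ s := mem_closedBall_self (norm_nonneg _)
  have hzs : z ∈ s := mem_closedBall_zero_iff.2 le_rfl
  have hsR : s ⊆ ball (0 : ℂ) R₀ := (closedBall_subset_closedBall hz).trans (closedBall_subset_ball hrR)
  have hsr : s ⊆ closedBall (0 : ℂ) r := closedBall_subset_closedBall hz
  have hd1 : ∀ w ∈ s, HasDerivAt F₁ (F₂ w) w := fun w hw ↦ (hA.deriv w (hsR hw)).differentiableAt.hasDerivAt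
  have hd2 : ∀ w ∈ s, HasDerivAt F₂ (F₃ w) w := fun w hw ↦ (hA.deriv.deriv w (hsR hw)).differentiableAt.hasDerivAt
  have hd3 : ∀ w ∈ s, HasDerivAt F₃ (F₄ w) w := fun w hw ↦
    (hA.deriv.deriv.deriv w (hsR hw)).differentiableAt.hasDerivAt
  have hM0 : 0 ≤ M := (norm_nonneg _).trans (hM 0 (mem_closedBall_self ((norm_nonneg z).trans hz)))
  -- `‖F₃ w - F₃ 0‖ ≤ M ‖z‖` on `s`
  have e3 : ∀ w ∈ s, ‖F₃ w - F₃ 0‖ ≤ M * ‖z‖ := fun w hw ↦ by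
    have := hsconv.norm_image_sub_le_of_norm_deriv_le (f := F₃) (C := M)
      (fun w hw ↦ (hd3 w hw).differentiableAt) (fun w hw ↦ by rw [(hd3 w hw).deriv]; exact hM w (hsr hw)) h0s hw
    rw [sub_zero] at this
    exact this.trans (mul_le_mul_of_nonneg_left (mem_closedBall_zero_iff.1 hw) hM0)
  -- `P₁ w := F₂ w - F₂ 0 - F₃ 0 w`, `‖P₁ w‖ ≤ M ‖z‖²`
  have e2 : ∀ w ∈ s, ‖F₂ w - F₂ 0 - F₃ 0 * w‖ ≤ M * ‖z‖ ^ 2 := fun w hw ↦ by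
    have hG : ∀ y ∈ s, HasDerivAt (fun y ↦ F₂ y - F₃ 0 * y) (F₃ y - F₃ 0) y := fun y hy ↦ by
      have := (hd2 y hy).sub ((hasDerivAt_id y).const_mul (F₃ 0))
      rw [mul_one] at this
      exact this
    have := hsconv.norm_image_sub_le_of_norm_deriv_le (f := fun y ↦ F₂ y - F₃ 0 * y) (C := M * ‖z‖)
      (fun y hy ↦ (hG y hy).differentiableAt) (fun y hy ↦ by rw [(hG y hy).deriv]; exact e3 y hy) h0s hw
    simp only [mul_zero, sub_zero] at this
    calc ‖F₂ w - F₂ 0 - F₃ 0 * w‖ = ‖F₂ w - F₃ 0 * w - F₂ 0‖ := by ring_nf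
      _ ≤ M * ‖z‖ * ‖w‖ := this
      _ ≤ M * ‖z‖ * ‖z‖ := mul_le_mul_of_nonneg_left (mem_closedBall_zero_iff.1 hw) (by positivity)
      _ = M * ‖z‖ ^ 2 := by ring
  -- `P w := F₁ w - F₂ 0 w - F₃ 0 w²/2`
  have hG : ∀ y ∈ s, HasDerivAt (fun y ↦ F₁ y - F₂ 0 * y - F₃ 0 * y ^ 2 / 2) (F₂ y - F₂ 0 - F₃ 0 * y) y := by
    intro y hy
    have := ((hd1 y hy).sub ((hasDerivAt_id y).const_mul (F₂ 0))).sub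
      ((((hasDerivAt_id y).pow 2).const_mul (F₃ 0)).div_const 2)
    refine this.congr_deriv ?_
    simp only [id_eq, mul_one, Nat.cast_ofNat]
    ring
  have := hsconv.norm_image_sub_le_of_norm_deriv_le (f := fun y ↦ F₁ y - F₂ 0 * y - F₃ 0 * y ^ 2 / 2)
    (C := M * ‖z‖ ^ 2) (fun y hy ↦ (hG y hy).differentiableAt) (fun y hy ↦ by rw [(hG y hy).deriv]; exact e2 y hy)
    h0s hzs
  simp only [mul_zero, sub_zero, ne_eq, OfNat.ofNat_ne_zero, not_false_eq_true, zero_pow, zero_div] at this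
  calc _ = ‖F₁ z - F₂ 0 * z - F₃ 0 * z ^ 2 / 2 - F₁ 0‖ := by ring_nf
    _ ≤ M * ‖z‖ ^ 2 * ‖z‖ := this
    _ = M * ‖z‖ ^ 3 := by ring

include hB hΦ hd hρ₀ hBρ in
/-- **Taylor expansion of `E_B'` at `0` to second order**: for `‖z‖ ≤ ρ₀/4`,
`‖E_B'(z) - d - E_B''(0) z - E_B⁽³⁾(0) z²/2‖ ≤ (8/ρ₀³) ‖z‖³`. [folklore] -/
theorem norm_deriv_hullExt_sub_taylor_le {z : ℂ} (hz : ‖z‖ ≤ ρ₀ / 4) :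
    ‖deriv (hullExt Φ) z - d - deriv (deriv (hullExt Φ)) 0 * z -
        deriv (deriv (deriv (hullExt Φ))) 0 * z ^ 2 / 2‖ ≤ 8 / ρ₀ ^ 3 * ‖z‖ ^ 3 := by
  obtain ⟨-, hE, -⟩ := differentiableOn_hmap hB hΦ hρ₀ hBρ
  obtain ⟨-, -, -, h4⟩ := norm_iteratedDeriv_hullExt_le hB hΦ hρ₀ hBρ
  have := norm_deriv_sub_taylor_le (F := hullExt Φ) (r := ρ₀ / 4) (R₀ := 4 * ρ₀) (by linarith) hE h4 hz
  rwa [deriv_hullExt_zero hB hΦ hd] at this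

include hB hΦ hd hρ₀ hBρ in
/-- **Bounds for the drift**: `‖D‖ ≤ 24/ρ₀` on `B̄(0, ρ₀/4)` (the Cauchy integral over `|ζ| = ρ₀/2`,
where `|d²/E_B| ≤ 8/ρ₀`, `|E_B'/ζ| ≤ 4/ρ₀`), hence `‖D'‖ ≤ 192/ρ₀²` on `B̄(0, ρ₀/8)` and
`‖D''‖ ≤ 3072/ρ₀³` on `B̄(0, ρ₀/16)`. [folklore] -/
theorem norm_driftFun_le :
    (∀ z ∈ closedBall (0 : ℂ) (ρ₀ / 4), ‖driftFun Φ d ρ₀ z‖ ≤ 24 / ρ₀) ∧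
    (∀ z ∈ closedBall (0 : ℂ) (ρ₀ / 8), ‖deriv (driftFun Φ d ρ₀) z‖ ≤ 192 / ρ₀ ^ 2) ∧
    (∀ z ∈ closedBall (0 : ℂ) (ρ₀ / 16), ‖deriv (deriv (driftFun Φ d ρ₀)) z‖ ≤ 3072 / ρ₀ ^ 3) := by
  obtain ⟨hsub, hE, -⟩ := differentiableOn_hmap hB hΦ hρ₀ hBρ
  obtain ⟨h1, -, -, -⟩ := norm_iteratedDeriv_hullExt_le hB hΦ hρ₀ hBρ
  obtain ⟨hd0, hd1⟩ := restrictionDeriv_pos_le_one hB hΦ hd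
  have hρ2 : 0 < ρ₀ / 2 := by positivity
  have hD := differentiableOn_driftFun hB hΦ hd hρ₀ hBρ
  -- the bound on the sphere and the Cauchy integral
  have h0 : ∀ z ∈ closedBall (0 : ℂ) (ρ₀ / 4), ‖driftFun Φ d ρ₀ z‖ ≤ 24 / ρ₀ := by
    intro z hz
    have hz' := mem_closedBall_zero_iff.1 hz
    rw [driftFun]
    have hpt : ∀ ζ ∈ sphere (0 : ℂ) (ρ₀ / 2),
        ‖(ζ - z)⁻¹ • ((d : ℂ) ^ 2 / hullExt Φ ζ - deriv (hullExt Φ) ζ / ζ)‖ ≤ 4 / ρ₀ * (12 / ρ₀) := by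
      intro ζ hζ
      have hζ' : ‖ζ‖ = ρ₀ / 2 := by simpa using hζ
      have hζ0 : ζ ≠ 0 := by intro h; rw [h, norm_zero] at hζ'; linarith
      have hζ4 : ζ ∈ ball (0 : ℂ) (4 * ρ₀) := mem_ball_zero_iff.2 (by linarith)
      have hζz : ζ - z ≠ 0 := by
        intro h; rw [sub_eq_zero] at h; rw [h] at hζ'; linarith
      have hinv : ‖(ζ - z)⁻¹‖ ≤ 4 / ρ₀ := by
        rw [norm_inv, inv_eq_one_div, div_le_div_iff₀ (norm_pos_iff.2 hζz) hρ₀]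
        have h' : ‖ζ‖ - ‖z‖ ≤ ‖ζ - z‖ := by
          have := abs_norm_sub_norm_le ζ z
          have := le_abs_self (‖ζ‖ - ‖z‖)
          linarith
        nlinarith
      have hEz : d * (ρ₀ / 2) / 4 ≤ ‖hullExt Φ ζ‖ :=
        norm_hullExt_ge hB hΦ hd hρ₀ hBρ hρ2 (by linarith) hζ4 hζ'.ge
      have hEpos : 0 < ‖hullExt Φ ζ‖ := lt_of_lt_of_le (by positivity) hEz
      have hP : ‖(d : ℂ) ^ 2 / hullExt Φ ζ‖ ≤ 8 / ρ₀ := by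
        rw [norm_div, norm_pow, norm_real, Real.norm_of_nonneg hd0.le, div_le_div_iff₀ hEpos hρ₀]
        have hdd : d ^ 2 * ρ₀ ≤ d * ρ₀ := by
          have := mul_le_mul_of_nonneg_left hd1 (by positivity : (0 : ℝ) ≤ d * ρ₀)
          nlinarith [this]
        nlinarith [hdd, mul_le_mul_of_nonneg_left hEz (by positivity : (0 : ℝ) ≤ 8)]
      have hQ : ‖deriv (hullExt Φ) ζ / ζ‖ ≤ 4 / ρ₀ := by
        rw [norm_div, hζ', div_le_div_iff₀ hρ2 hρ₀]
        nlinarith [h1 ζ hζ4]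
      rw [norm_smul]
      refine mul_le_mul hinv ((norm_sub_le _ _).trans ?_) (norm_nonneg _) (by positivity)
      have : (8 : ℝ) / ρ₀ + 4 / ρ₀ = 12 / ρ₀ := by ring
      linarith
    have := circleIntegral.norm_two_pi_i_inv_smul_integral_le_of_norm_le_const hρ2.le hpt
    refine this.trans (le_of_eq ?_)
    field_simp
    norm_num
  have hDer1 : ∀ z ∈ closedBall (0 : ℂ) (ρ₀ / 8), ‖deriv (driftFun Φ d ρ₀) z‖ ≤ 192 / ρ₀ ^ 2 := fun z hz ↦ by
    have := norm_deriv_le_of_forall_closedBall (F := driftFun Φ d ρ₀) (r := ρ₀ / 8) (r' := ρ₀ / 8)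
      (M := 24 / ρ₀) (by positivity) (by linarith) hD
      (fun w hw ↦ h0 w (by simpa [show ρ₀ / 8 + ρ₀ / 8 = ρ₀ / 4 by ring] using hw)) hz
    refine this.trans (le_of_eq ?_); field_simp; ring
  have hDer2 : ∀ z ∈ closedBall (0 : ℂ) (ρ₀ / 16), ‖deriv (deriv (driftFun Φ d ρ₀)) z‖ ≤ 3072 / ρ₀ ^ 3 :=
    fun z hz ↦ by
    have hD' : DifferentiableOn ℂ (deriv (driftFun Φ d ρ₀)) (ball (0 : ℂ) (ρ₀ / 2)) :=
      ((hD.analyticOnNhd isOpen_ball).deriv).differentiableOn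
    have := norm_deriv_le_of_forall_closedBall (F := deriv (driftFun Φ d ρ₀)) (r := ρ₀ / 16) (r' := ρ₀ / 16)
      (M := 192 / ρ₀ ^ 2) (by positivity) (by linarith) hD'
      (fun w hw ↦ hDer1 w (by simpa [show ρ₀ / 16 + ρ₀ / 16 = ρ₀ / 8 by ring] using hw)) hz
    refine this.trans (le_of_eq ?_); field_simp; ring
  exact ⟨h0, hDer1, hDer2⟩

include hB hΦ hd hρ₀ hBρ in
/-- `‖D'(z) - D'(0)‖ ≤ (3072/ρ₀³) ‖z‖` for `‖z‖ ≤ ρ₀/16` (mean value inequality). [folklore] -/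
theorem norm_deriv_driftFun_sub_le {z : ℂ} (hz : ‖z‖ ≤ ρ₀ / 16) :
    ‖deriv (driftFun Φ d ρ₀) z - deriv (driftFun Φ d ρ₀) 0‖ ≤ 3072 / ρ₀ ^ 3 * ‖z‖ := by
  obtain ⟨-, -, h2⟩ := norm_driftFun_le hB hΦ hd hρ₀ hBρ
  have hD := differentiableOn_driftFun hB hΦ hd hρ₀ hBρ
  have hA := (hD.analyticOnNhd isOpen_ball).deriv
  have hsub : closedBall (0 : ℂ) (ρ₀ / 16) ⊆ ball (0 : ℂ) (ρ₀ / 2) := closedBall_subset_ball (by linarith)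
  have := (convex_closedBall (0 : ℂ) (ρ₀ / 16)).norm_image_sub_le_of_norm_deriv_le (f := deriv (driftFun Φ d ρ₀))
    (C := 3072 / ρ₀ ^ 3) (fun w hw ↦ (hA w (hsub hw)).differentiableAt)
    (fun w hw ↦ by rw [((hA w (hsub hw)).differentiableAt.hasDerivAt).deriv]; exact h2 w hw)
    (mem_closedBall_self (by positivity)) (mem_closedBall_zero_iff.2 hz)
  rwa [sub_zero] at this

/-! ### Reality of the jets on the real axis -/

/-- If `F` is holomorphic on `B(0, R)` and real on the real points of the ball, then `F'(x) ∈ ℝ`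
for real `|x| < R`. [folklore] -/
theorem im_deriv_eq_zero_of_im_eq_zero {F : ℂ → ℂ} {R : ℝ} (hF : DifferentiableOn ℂ F (ball (0 : ℂ) R))
    (hreal : ∀ x : ℝ, |x| < R → (F x).im = 0) {x : ℝ} (hx : |x| < R) : (deriv F x).im = 0 := by
  have hxb : (x : ℂ) ∈ ball (0 : ℂ) R := by
    rw [mem_ball_zero_iff, norm_real, Real.norm_eq_abs]; exact hx
  have hFd : HasDerivAt F (deriv F x) x := (hF.differentiableAt (isOpen_ball.mem_nhds hxb)).hasDerivAt
  -- the real function `t ↦ im (F t)` vanishes near `x`, so its derivative `im (F' x)` is `0`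
  have h1 : HasDerivAt (fun t : ℝ ↦ F t) (deriv F x) x := by
    simpa using hFd.comp_ofReal
  have hc : HasDerivAt (fun t : ℝ ↦ (F t).im) (deriv F x).im x :=
    Complex.imCLM.hasFDerivAt.comp_hasDerivAt x h1
  have hev : (fun t : ℝ ↦ (F t).im) =ᶠ[𝓝 x] fun _ ↦ (0 : ℝ) := by
    have : {t : ℝ | |t| < R} ∈ 𝓝 x := (isOpen_lt continuous_abs continuous_const).mem_nhds hx
    filter_upwards [this] with t ht using hreal t ht
  have h0 : HasDerivAt (fun t : ℝ ↦ (F t).im) 0 x := (hasDerivAt_const x (0 : ℝ)).congr_of_eventuallyEq hev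
  exact hc.unique h0

include hB hΦ hρ₀ hBρ in
/-- **The jets of `E_B` at real points are real**: `E_B^{(k)}(x) ∈ ℝ` for `k ≤ 3`, real `|x| < 4ρ₀`
(`E_B` is real on the real axis, `hullExt_ofReal_im`). [folklore] -/
theorem im_iteratedDeriv_hullExt_ofReal {x : ℝ} (hx : |x| < 4 * ρ₀) :
    (deriv (hullExt Φ) x).im = 0 ∧ (deriv (deriv (hullExt Φ)) x).im = 0 ∧
      (deriv (deriv (deriv (hullExt Φ))) x).im = 0 := by
  obtain ⟨hsub, hE, -⟩ := differentiableOn_hmap hB hΦ hρ₀ hBρ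
  have hA : AnalyticOnNhd ℂ (hullExt Φ) (ball (0 : ℂ) (4 * ρ₀)) := hE.analyticOnNhd isOpen_ball
  have h0 : ∀ y : ℝ, |y| < 4 * ρ₀ → (hullExt Φ y).im = 0 := fun y hy ↦ by
    refine hullExt_ofReal_im hB.isBoundedHull hΦ fun hyB ↦ ?_
    have := le_norm_of_mem hBρ hyB
    rw [norm_real, Real.norm_eq_abs] at this
    linarith
  have h1 : ∀ y : ℝ, |y| < 4 * ρ₀ → (deriv (hullExt Φ) y).im = 0 := fun y hy ↦
    im_deriv_eq_zero_of_im_eq_zero hE h0 hy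
  have h2 : ∀ y : ℝ, |y| < 4 * ρ₀ → (deriv (deriv (hullExt Φ)) y).im = 0 := fun y hy ↦
    im_deriv_eq_zero_of_im_eq_zero hA.deriv.differentiableOn h1 hy
  have h3 : ∀ y : ℝ, |y| < 4 * ρ₀ → (deriv (deriv (deriv (hullExt Φ))) y).im = 0 := fun y hy ↦
    im_deriv_eq_zero_of_im_eq_zero hA.deriv.deriv.differentiableOn h2 hy
  exact ⟨h1 x hx, h2 x hx, h3 x hx⟩

end Loewner

end Literature.Probability.RandomPlanarGeometry
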